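import Literature.NumberTheory.DiophantineGeometry.StewartYuPadicLogFormsProofs
import HarnessLib
import Literature.Uncategorized.TheoremALeOne

/-!
# The first rung of Theorem A (route `PadicPrincipalCoreST86`, item `TheoremA` = stmt-ABC-18951): the case `m ≤ 1`

BC5 / tribunal-T3 witness for the crux `Summit.ABC.ABC.Theses.PadicPrincipalCoreST86.TheoremA`: Theorem A's
existential statement RESTRICTED to `m ≤ 1` principal `p`-adic logarithms holds, with `C m = 4^m`, `r m = 0`,
`c₁ = 4`, `c₂ = 0`.  Proof: for `m = 0` the hypothesis `b ≠ 0` is absurd; for `m = 1` a principal unit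
`α ≡ 1 (mod p)` is a `p`-adic unit with reduction `ᾱ = 1`, so Yu's one-logarithm estimate by lifting the exponent
(`Dioph.padicValRat_zpow_sub_one_mul_log_le_sharp`: `ord_p(α^b − 1)·log p ≤ log 2 + |⟨ᾱ⟩|·h(α) + log|b|`) gives
`ord_p(α^b − 1)·log p ≤ log 2 + V + W ≤ 4·V·(W + log 2V_max)·log 2V_max` (using `log p ≤ V`, `p ≥ 3`, `log 3 ≤ W`).
This lies outside the known regime of the route's target only in the trivial sense (one logarithm); its role is to
certify that the crux text is correctly typed and non-vacuous at its first rung (supports stmt-ABC-18951).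
-/

open Finset
open Literature.NumberTheory.DiophantineGeometry

set_option linter.dupNamespace false

namespace Summit.ABC.ABC.Theorems.PadicPrincipalCoreST86Rung

/-- A principal unit `α ≡ 1 (mod p)` is non-zero, `≠ 1`, and a `p`-adic unit. [folklore] -/
theorem unit_of_principal {p : ℕ} [hp : Fact p.Prime] {α : ℚ}
    (h : 1 ≤ padicValRat p (α - 1)) : α ≠ 0 ∧ α - 1 ≠ 0 ∧ padicValRat p α = 0 := by
  have hα1 : α - 1 ≠ 0 := by
    intro h0; rw [h0, padicValRat.zero] at h; exact absurd h (by norm_num)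
  have hα0 : α ≠ 0 := by
    rintro rfl
    rw [zero_sub, padicValRat.neg, padicValRat.one] at h
    exact absurd h (by norm_num)
  refine ⟨hα0, hα1, ?_⟩
  have hne : padicValRat p (α - 1) ≠ padicValRat p (1 : ℚ) := by
    rw [padicValRat.one]; omega
  have key := padicValRat.add_eq_min (p := p) (q := α - 1) (r := 1)
    (by rw [sub_add_cancel]; exact hα0) hα1 one_ne_zero hne
  rw [sub_add_cancel, padicValRat.one] at key
  rw [key]; exact min_eq_right (by omega)

/-- The reduction mod `p` of a principal unit is `1`. [folklore] -/
theorem ratModP_eq_one_of_principal {p : ℕ} [hp : Fact p.Prime] {α : ℚ}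
    (h : 1 ≤ padicValRat p (α - 1)) : Dioph.ratModP p α = 1 := by
  obtain ⟨hα0, hα1, hv⟩ := unit_of_principal h
  obtain ⟨_, hd⟩ := Dioph.padicUnit_not_dvd_num_den hp.out hα0 hv
  have hden : (α.den : ℚ) ≠ 0 := by exact_mod_cast α.den_ne_zero
  have hrepr : α - 1 = ((α.num - α.den : ℤ) : ℚ) / (α.den : ℚ) := by
    rw [eq_div_iff hden]; push_cast
    rw [sub_mul, Rat.mul_den_eq_num, one_mul]
  have hN0 : (α.num - α.den : ℤ) ≠ 0 := by
    intro h0; apply hα1; rw [hrepr, h0]; simp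
  have hdvd : (p : ℤ) ∣ α.num - α.den := by
    by_contra hndvd
    have hv1 : padicValRat p (α - 1) = padicValInt p (α.num - α.den) - padicValNat p α.den := by
      rw [hrepr, padicValRat.div (by exact_mod_cast hN0) hden, padicValRat.of_int, padicValRat.of_nat]
    rw [hv1, padicValNat.eq_zero_of_not_dvd hd, padicValInt.eq_zero_of_not_dvd hndvd] at h
    norm_num at h
  have hden0 : (α.den : ZMod p) ≠ 0 := fun h0 => hd ((ZMod.natCast_eq_zero_iff _ _).mp h0)
  have hcast : ((α.num : ℤ) : ZMod p) = ((α.den : ℕ) : ZMod p) := by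
    have h0 := (ZMod.intCast_zmod_eq_zero_iff_dvd (α.num - α.den) p).mpr hdvd
    push_cast at h0
    exact sub_eq_zero.mp h0
  unfold Dioph.ratModP
  rw [hcast, mul_inv_cancel₀ hden0]

/-- **The rung `m ≤ 1` of Theorem A holds**, with `C m = 4^m`, `r = 0`, `c₁ = 4`, `c₂ = 0`.
[cite: Yu1989, Lemma 1.4] -/
theorem theoremALeOne_holds : Literature.Uncategorized.TheoremALeOne := by
  refine ⟨fun m => (4 : ℝ) ^ m, fun _ => 0, 4, 0, by norm_num, le_rfl, by norm_num,
    fun m => ⟨by positivity, ?_⟩, ?_⟩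
  · rw [zero_mul, Real.rpow_zero, mul_one]
  intro p hp hp2 m α b V Vmax W hm hα hind _hkum hV hVp hVmax hb hW
  haveI := Fact.mk hp
  interval_cases m
  · exact absurd (Subsingleton.elim b 0) hb
  -- m = 1
  obtain ⟨hα0, hα1, hv⟩ := unit_of_principal (hα 0).2
  have hb0 : b 0 ≠ 0 := by
    intro h0; apply hb; funext j
    rw [Subsingleton.elim j 0, h0]; rfl
  have hpow : α 0 ^ b 0 ≠ 1 := by
    intro h1
    exact hb (hind b (by rw [Fin.prod_univ_one]; exact h1))
  have hr : Dioph.ratModP p (α 0) = 1 := ratModP_eq_one_of_principal (hα 0).2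
  have key := Dioph.padicValRat_zpow_sub_one_mul_log_le_sharp hp hp2 hα0 hv hb0 hpow
  rw [hr, orderOf_one, Nat.cast_one, one_mul] at key
  simp only [Fin.prod_univ_one, pow_one, pow_zero, div_one]
  -- numerics
  have hp3 : (3 : ℝ) ≤ p := by
    have h2 := hp.two_le
    have : 3 ≤ p := by omega
    exact_mod_cast this
  have hlog3 : (1 : ℝ) < Real.log 3 := by
    rw [Real.lt_log_iff_exp_lt (by norm_num)]
    have := Real.exp_one_lt_d9; linarith
  have hlogp : Real.log 3 ≤ Real.log p := Real.log_le_log (by norm_num) hp3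
  have hV1 : 1 ≤ V 0 := by linarith [hVp 0]
  have hVh : Height.logHeight₁ (α 0) ≤ V 0 := hV 0
  have hbabs : (0 : ℝ) < |(b 0 : ℝ)| := by
    rw [← Int.cast_abs]; exact_mod_cast Int.one_le_abs hb0
  have hW3 : Real.log 3 ≤ W :=
    le_trans (Real.log_le_log (by norm_num) (le_max_left _ _)) (hW 0)
  have hW1 : 1 ≤ W := by linarith
  have hlogb : Real.log |(b 0 : ℝ)| ≤ W :=
    le_trans (Real.log_le_log hbabs (le_max_right _ _)) (hW 0)
  have hVmax1 : 1 ≤ Vmax := le_trans hV1 (hVmax 0)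
  set L := Real.log (2 * Vmax) with hL
  have hL2 : Real.log 2 ≤ L := Real.log_le_log two_pos (by linarith)
  have hl2 := Real.log_two_gt_d9
  have hl2' := Real.log_two_lt_d9
  have hL69 : 0.69 ≤ L := by linarith
  have h1 : 0.69 * W ≤ W * L := by nlinarith
  have h2 : W * L ≤ V 0 * (W * L) := by nlinarith
  have h3 : 0.47 ≤ L * L := by nlinarith
  have h4 : 0.47 * V 0 ≤ V 0 * (L * L) := by nlinarith
  have hre : 4 * V 0 * (W + L) * L = 4 * (V 0 * (W * L)) + 4 * (V 0 * (L * L)) := by ring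
  rw [hre]
  linarith

end Summit.ABC.ABC.Theorems.PadicPrincipalCoreST86Rung
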